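import Mathlib
import Summits.NavierStokesRegularity.NavierStokesRegularity.Theorems.ThreadingFluxHorizonTowerDefs
import HarnessLib

/-!
# Crux `PoloidalLiouville` (stmt-NavierStokesRegularity-1222, wall W1), crux idea «horizon-threading-tower» (ns-idea-15):
# smooth homogeneous functions are their top Taylor term; a smooth degree-3 homogeneous `H : ℝ³ → ℝ` is a cubic form

Support file (Theorems-side tooling, `--supports stmt-NavierStokesRegularity-1222 --as helper`; seat ns-wall-eng-7 g3, cell ns-wall-extremal,
item HT1-CERT-CORE).  The hypotheses of `HorizonTower.HorizonZonalitySingleDegree` describe the degree-`l` solid harmonic ABSTRACTLY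
(`ContDiff ℝ ⊤ H`, `H (c • y) = c ^ l * H y`, `ΔH = 0`), while the kernel certificate (`CubicCert.*`) is about the EXPLICIT family
`cubicHE3 a`.  This file supplies the first half of the bridge (no harmonicity used):

* `HorizonTower.factorial_mul_eq_iteratedFDeriv_of_homogeneous` — if `H` is `C^l` and `H (c • y) = c ^ l * H y` for all real `c`, then
  `l! · H(y) = D^l H(0)(y, …, y)` (restrict to the line `c ↦ c • y`, where `H` is the monomial `c^l H(y)`, and use
  `ContinuousLinearMap.iteratedFDeriv_comp_right`);
* `HorizonTower.sum_pi_fin3` — a sum over `Fin 3 → Fin 3` is a triple sum;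
* `HorizonTower.exists_cubicCoeff_of_homogeneous` — for `l = 3`: `∃ T : Fin 3 → Fin 3 → Fin 3 → ℝ, ∀ y, H y = Σᵢⱼₖ T i j k · yᵢ yⱼ yₖ`
  (expand `D³H(0)(y,y,y)` by multilinearity in the standard basis).

Pure calculus; information-grade for W1/W2; `PoloidalLiouville` (1222) / NS regularity OPEN and untouched. [folklore]
-/

-- the summit and its single problem share the name (D-0017 nested layout)
set_option linter.dupNamespace false

noncomputable section

open scoped RealInnerProductSpace

namespace Summit.NavierStokesRegularity.NavierStokesRegularity.Theorems.PoloidalLiouville.HorizonTower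

/-- **Homogeneous ⇒ top Taylor term.**  If `H : ℝ³ → ℝ` is `C^l` and `H (c • y) = c ^ l * H y` for all real `c` and all `y`, then
`l! · H(y) = D^lH(0)(y, …, y)`. [folklore] -/
theorem factorial_mul_eq_iteratedFDeriv_of_homogeneous {H : E3 → ℝ} {l : ℕ} (hH : ContDiff ℝ l H)
    (hhom : ∀ (c : ℝ) (y : E3), H (c • y) = c ^ l * H y) (y : E3) :
    (l.factorial : ℝ) * H y = iteratedFDeriv ℝ l H 0 (fun _ => y) := by
  have h1 : iteratedDeriv l (fun c : ℝ => H (c • y)) 0 = (l.factorial : ℝ) * H y := by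
    have hfun : (fun c : ℝ => H (c • y)) = fun c => c ^ l * H y := funext fun c => hhom c y
    rw [hfun, iteratedDeriv_mul_const_field, iteratedDeriv_fun_pow_zero]
    simp
  have h2 : iteratedDeriv l (fun c : ℝ => H (c • y)) 0 = iteratedFDeriv ℝ l H 0 (fun _ => y) := by
    have hcomp : (fun c : ℝ => H (c • y)) = H ∘ (ContinuousLinearMap.toSpanSingleton ℝ y) := by
      funext c
      simp [ContinuousLinearMap.toSpanSingleton_apply]
    rw [iteratedDeriv_eq_iteratedFDeriv, hcomp,
      (ContinuousLinearMap.toSpanSingleton ℝ y).iteratedFDeriv_comp_right hH 0 (by exact_mod_cast le_rfl)]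
    simp [ContinuousLinearMap.toSpanSingleton_apply]
  rw [← h1, h2]

/-- A sum over the function type `Fin 3 → Fin 3` is a triple sum. [folklore] -/
theorem sum_pi_fin3 (F : (Fin 3 → Fin 3) → ℝ) : ∑ σ : Fin 3 → Fin 3, F σ = ∑ i : Fin 3, ∑ j : Fin 3, ∑ k : Fin 3, F ![i, j, k] := by
  let e : Fin 3 × Fin 3 × Fin 3 ≃ (Fin 3 → Fin 3) :=
    { toFun := fun p => ![p.1, p.2.1, p.2.2]
      invFun := fun σ => (σ 0, σ 1, σ 2)
      left_inv := by intro p; simp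
      right_inv := by
        intro σ
        funext i
        fin_cases i <;> simp }
  rw [← Fintype.sum_equiv e (fun p => F (e p)) F (fun _ => rfl), Fintype.sum_prod_type]
  refine Finset.sum_congr rfl fun i _ => ?_
  rw [Fintype.sum_prod_type]
  rfl

/-- **A smooth degree-3 homogeneous function on `ℝ³` is a cubic form**: `H y = Σᵢⱼₖ Tᵢⱼₖ yᵢ yⱼ yₖ` with `Tᵢⱼₖ = D³H(0)(eᵢ,eⱼ,eₖ)/6`. [folklore] -/
theorem exists_cubicCoeff_of_homogeneous {H : E3 → ℝ} (hH : ContDiff ℝ 3 H) (hhom : ∀ (c : ℝ) (y : E3), H (c • y) = c ^ 3 * H y) :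
    ∃ T : Fin 3 → Fin 3 → Fin 3 → ℝ, ∀ y : E3, H y = ∑ i : Fin 3, ∑ j : Fin 3, ∑ k : Fin 3, T i j k * (y i * y j * y k) := by
  classical
  set M := iteratedFDeriv ℝ 3 H 0 with hM
  set e : Fin 3 → E3 := fun i => EuclideanSpace.single i (1 : ℝ) with he
  refine ⟨fun i j k => M ![e i, e j, e k] / 6, fun y => ?_⟩
  have h6 : (6 : ℝ) * H y = M (fun _ => y) := by
    have := factorial_mul_eq_iteratedFDeriv_of_homogeneous hH hhom y
    norm_num [Nat.factorial] at this
    rw [hM]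
    exact_mod_cast this
  -- expand `y` in the standard basis inside every slot
  have hy : (fun _ : Fin 3 => y) = fun _ : Fin 3 => ∑ i : Fin 3, y i • e i := by
    funext j
    simpa [he] using ((EuclideanSpace.basisFun (Fin 3) ℝ).sum_repr y).symm
  have hexp : M (fun _ => y) = ∑ σ : Fin 3 → Fin 3, (∏ j : Fin 3, y (σ j)) * M (fun j => e (σ j)) := by
    rw [hy, M.map_sum (fun (_ : Fin 3) (i : Fin 3) => y i • e i)]
    refine Finset.sum_congr rfl fun σ _ => ?_
    rw [M.map_smul_univ (fun j => y (σ j)) (fun j => e (σ j)), smul_eq_mul]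
  rw [sum_pi_fin3] at hexp
  have hH6 : H y = (1 / 6) * M (fun _ => y) := by rw [← h6]; ring
  rw [hH6, hexp, Finset.mul_sum]
  refine Finset.sum_congr rfl fun i _ => ?_
  rw [Finset.mul_sum]
  refine Finset.sum_congr rfl fun j _ => ?_
  rw [Finset.mul_sum]
  refine Finset.sum_congr rfl fun k _ => ?_
  have hfun : (fun m : Fin 3 => e (![i, j, k] m)) = ![e i, e j, e k] := by
    funext m
    fin_cases m <;> simp
  rw [Fin.prod_univ_three, hfun]
  simp only [Matrix.cons_val_zero, Matrix.cons_val_one, Matrix.cons_val_two, Matrix.head_cons, Matrix.tail_cons]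
  ring

end Summit.NavierStokesRegularity.NavierStokesRegularity.Theorems.PoloidalLiouville.HorizonTower

end
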